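import Mathlib
import Summits.MatrixMultiplication.MatrixMultiplication.Theorems.SnSubsetDichotomyPolynomialSlackBalancedThreeQuarters

/-!
# Polynomial slack for TPP triples whose smallest member is not too small (conditional)

Crux `Summit.MatrixMultiplication.MatrixMultiplication.Theses.SnSubsetDichotomy.PolynomialSlack`
(item `stmt-MatrixMultiplication-8306`), level-one programme: the exact reach of the near-wall inequality
`nearWall`. For every exponent `C < 1` there is `n₀` such that every TPP triple `S, T, U ⊆ S_n`, `n ≥ n₀`,
all of whose members have at least `3·10⁶·√(n!)·n^{C-1}·log² n` elements satisfies the crux inequality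
`|S||T||U|·n^C ≤ (n!)^{3/2}` (`slack_of_minCard`). (A triple violating the crux inequality at exponent `C`
has all three members of size between `√(n!)·n^{-C}` and `√(n!)·n^{C}`; the theorem says the violation
forces one member below `√(n!)·n^{C-1}·polylog` — for balanced triples this is impossible when `C < 3/4`,
which is `balanced_slack_of_lt_threeQuarters`; the LOPSIDED range `[√(n!)n^{-C}, √(n!)n^{C-1}·polylog]`
for the smallest member is what level one leaves open.)

UNCONDITIONAL (rests on the tree's own Bernstein inequality `card_permutedSum_tail_le` through `nearWall`).
-/

namespace Summit.MatrixMultiplication.MatrixMultiplication.Theorems.PolynomialSlack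

open scoped BigOperators
open Literature.Combinatorics.Additive (TripleProductProperty)

-- `Summit.<Summit>.<Problem>` is the tree's mandated summit-side namespace (CONVENTIONS §2); for
-- this single-conjunct summit the two coincide, so each declaration silences `dupNamespace`.
set_option linter.dupNamespace false

/-- **Polynomial slack above a size threshold** (unconditional): for every real `C < 1` there is `n₀`
such that for all `n ≥ n₀` and all `S, T, U ⊆ S_n` with the triple product property and
`|S|, |T|, |U| ≥ 3·10⁶·√(n!)·n^{C-1}·log² n` one has `|S||T||U|·n^C ≤ (n!)^{3/2}`.
Proof: for `C < 1/2` this is `polynomialSlack_of_lt_half`; otherwise, if `|S||T||U|·n^C > (n!)^{3/2}`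
then every member exceeds `√(n!)/n^C`, every pair product exceeds `n!/n^{2C}`, so the logarithms in
`nearWall` are `≤ (1 + log n)·4 log n ≤ 9 log² n`, each pair term is `≤ 3 log n·√(|S||T||U|/t₀)` (`t₀` the
threshold), and `nearWall` squares to `|S||T||U| ≤ 2073600·(n!)²·log² n/(n·t₀) < (n!)^{3/2}/n^C`, a
contradiction. -/
theorem slack_of_minCard (C : ℝ) (hC : C < 1) :
    ∃ n₀ : ℕ, ∀ n ≥ n₀, ∀ S T U : Finset (Equiv.Perm (Fin n)), TripleProductProperty S T U →
      3000000 * Real.sqrt (n.factorial : ℝ) * (n : ℝ) ^ (C - 1) * Real.log n ^ 2 ≤ S.card →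
      3000000 * Real.sqrt (n.factorial : ℝ) * (n : ℝ) ^ (C - 1) * Real.log n ^ 2 ≤ T.card →
      3000000 * Real.sqrt (n.factorial : ℝ) * (n : ℝ) ^ (C - 1) * Real.log n ^ 2 ≤ U.card →
      ((S.card * T.card * U.card : ℕ) : ℝ) * (n : ℝ) ^ C ≤ (n.factorial : ℝ) ^ ((3 : ℝ) / 2) := by
  by_cases hC2 : C < 1 / 2
  · obtain ⟨n₀, hn₀⟩ := polynomialSlack_of_lt_half C hC2
    exact ⟨n₀, fun n hn S T U hTPP _ _ _ => hn₀ n hn S T U hTPP⟩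
  rw [not_lt] at hC2
  have h1C : 0 < 1 - C := by linarith
  have E1 : ∀ᶠ x : ℝ in Filter.atTop, 64 ≤ x ^ (1 - C) := (tendsto_rpow_atTop h1C).eventually_ge_atTop 64
  obtain ⟨x₀, hx₀⟩ := Filter.eventually_atTop.mp (E1.and (Filter.eventually_ge_atTop 40))
  refine ⟨⌈x₀⌉₊, fun n hn S T U hTPP hSmin hTmin hUmin => ?_⟩
  have hnx : x₀ ≤ n := (Nat.le_ceil x₀).trans (by exact_mod_cast hn)
  obtain ⟨hE1, h40⟩ := hx₀ n hnx
  have hn40 : 40 ≤ n := by exact_mod_cast h40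
  have hn0 : (0 : ℝ) < n := by linarith only [h40]
  have hF0 : (0 : ℝ) < n.factorial := by exact_mod_cast n.factorial_pos
  -- the players: `f = √(n!)`, `p = n^C`, `s = √n`, `ℓ = √(log n)`, `a, b, c` the three sizes
  obtain ⟨f, hf⟩ : ∃ f : ℝ, f = Real.sqrt (n.factorial : ℝ) := ⟨_, rfl⟩
  obtain ⟨p, hp⟩ : ∃ p : ℝ, p = (n : ℝ) ^ C := ⟨_, rfl⟩
  obtain ⟨s, hs⟩ : ∃ s : ℝ, s = Real.sqrt (n : ℝ) := ⟨_, rfl⟩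
  obtain ⟨ℓ, hℓ⟩ : ∃ ℓ : ℝ, ℓ = Real.sqrt (Real.log n) := ⟨_, rfl⟩
  obtain ⟨a, ha⟩ : ∃ a : ℝ, a = (S.card : ℝ) := ⟨_, rfl⟩
  obtain ⟨b, hb⟩ : ∃ b : ℝ, b = (T.card : ℝ) := ⟨_, rfl⟩
  obtain ⟨c, hc⟩ : ∃ c : ℝ, c = (U.card : ℝ) := ⟨_, rfl⟩
  have hf0 : 0 < f := by rw [hf]; exact Real.sqrt_pos.mpr hF0
  have hp0 : 0 < p := by rw [hp]; positivity
  have hs0 : 0 < s := by rw [hs]; exact Real.sqrt_pos.mpr hn0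
  have hlogpos : 0 < Real.log n := Real.log_pos (by linarith only [h40])
  have hlog1 : 1 ≤ Real.log n := by
    rw [← Real.log_exp 1]
    exact Real.log_le_log (Real.exp_pos 1) (le_trans (le_of_lt (lt_trans Real.exp_one_lt_d9 (by norm_num))) h40)
  have hℓpos : 0 < ℓ := by rw [hℓ]; exact Real.sqrt_pos.mpr hlogpos
  have hFf : (n.factorial : ℝ) = f ^ 2 := by rw [hf, Real.sq_sqrt hF0.le]
  have hns : (n : ℝ) = s ^ 2 := by rw [hs, Real.sq_sqrt hn0.le]
  have hlog : Real.log n = ℓ ^ 2 := by rw [hℓ, Real.sq_sqrt hlogpos.le]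
  have hF32 : (n.factorial : ℝ) ^ ((3 : ℝ) / 2) = f ^ 3 := by
    rw [hf, Real.sqrt_eq_rpow, ← Real.rpow_natCast, ← Real.rpow_mul hF0.le]; congr 1; norm_num
  -- the threshold `t₀ = 3·10⁶ f p ℓ⁴ / n`
  obtain ⟨t₀, ht⟩ : ∃ t₀ : ℝ, t₀ = 3000000 * f * p * ℓ ^ 4 / n := ⟨_, rfl⟩
  have hT0 : 3000000 * Real.sqrt (n.factorial : ℝ) * (n : ℝ) ^ (C - 1) * Real.log n ^ 2 = t₀ := by
    rw [ht, ← hf, Real.rpow_sub_one hn0.ne', ← hp, hlog]; ring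
  rw [hT0, ← ha] at hSmin
  rw [hT0, ← hb] at hTmin
  rw [hT0, ← hc] at hUmin
  have ht0 : 0 < t₀ := by rw [ht]; positivity
  have htn : t₀ * n = 3000000 * f * p * ℓ ^ 4 := by rw [ht]; field_simp
  -- (E1'): `64 p ≤ n`
  have hE1' : 64 * p ≤ n := by
    have e : (n : ℝ) = (n : ℝ) ^ (1 - C) * p := by
      rw [hp, ← Real.rpow_add hn0, sub_add_cancel, Real.rpow_one]
    rw [e]; exact mul_le_mul_of_nonneg_right hE1 hp0.le
  -- `f ≥ n/2`
  have hfn : (n : ℝ) / 2 ≤ f := by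
    have h1 : ((n * (n - 1) : ℕ) : ℝ) ≤ n.factorial := by
      have : n * (n - 1) ≤ n.factorial := by
        rw [← Nat.mul_factorial_pred (show n ≠ 0 by omega)]
        exact Nat.mul_le_mul_left n (Nat.self_le_factorial _)
      exact_mod_cast this
    have h2 : ((n * (n - 1) : ℕ) : ℝ) = (n : ℝ) * ((n : ℝ) - 1) := by
      push_cast [Nat.cast_sub (show 1 ≤ n by omega)]; ring
    have h3 : ((n : ℝ) / 2) ^ 2 ≤ n.factorial := by nlinarith only [h1, h2, h40]
    have := Real.abs_le_sqrt h3
    rwa [abs_of_nonneg (by positivity), ← hf] at this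
  -- the near-wall inequality, in the players' terms
  have hW := nearWall hn40 S T U hTPP
  have hN : ((S.card * T.card * U.card : ℕ) : ℝ) = a * b * c := by rw [ha, hb, hc]; push_cast; ring
  have hAB : ((S.card * T.card : ℕ) : ℝ) = a * b := by rw [ha, hb]; push_cast; ring
  have hBC : ((T.card * U.card : ℕ) : ℝ) = b * c := by rw [hb, hc]; push_cast; ring
  have hCA : ((U.card * S.card : ℕ) : ℝ) = c * a := by rw [hc, ha]; push_cast; ring
  rw [hN, hAB, hBC, hCA, ← hs] at hW
  rw [hN, ← hp, hF32]
  -- suppose the crux inequality fails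
  by_contra hcon
  rw [not_le] at hcon
  -- then the three sets are non-empty
  have hS0 : S.card ≠ 0 := by
    intro h; rw [ha] at hcon; simp only [h, Nat.cast_zero, zero_mul] at hcon; linarith [pow_pos hf0 3]
  have hT0' : T.card ≠ 0 := by
    intro h; rw [hb] at hcon; simp only [h, Nat.cast_zero, zero_mul, mul_zero] at hcon; linarith [pow_pos hf0 3]
  have hU0 : U.card ≠ 0 := by
    intro h; rw [hc] at hcon; simp only [h, Nat.cast_zero, zero_mul, mul_zero] at hcon; linarith [pow_pos hf0 3]
  have ha0 : 0 < a := by rw [ha]; exact_mod_cast Nat.pos_of_ne_zero hS0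
  have hb0 : 0 < b := by rw [hb]; exact_mod_cast Nat.pos_of_ne_zero hT0'
  have hc0 : 0 < c := by rw [hc]; exact_mod_cast Nat.pos_of_ne_zero hU0
  have hSne : S.Nonempty := Finset.card_pos.mp (Nat.pos_of_ne_zero hS0)
  have hTne : T.Nonempty := Finset.card_pos.mp (Nat.pos_of_ne_zero hT0')
  have hUne : U.Nonempty := Finset.card_pos.mp (Nat.pos_of_ne_zero hU0)
  have hN0 : 0 < a * b * c := by positivity
  -- pair products are at most `n! = f²`
  have hab : a * b ≤ f ^ 2 := by
    have := card_mul_card_le_factorial_of_injOn (injOn_quot_first hTPP hUne)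
    rw [ha, hb, ← hFf]; exact_mod_cast this
  have hbc : b * c ≤ f ^ 2 := by
    have := card_mul_card_le_factorial_of_injOn (injOn_quot_second hTPP hSne)
    rw [hb, hc, ← hFf]; exact_mod_cast this
  have hca : c * a ≤ f ^ 2 := by
    have := card_mul_card_le_factorial_of_injOn (injOn_quot_first hTPP.rotate.rotate hTne)
    rw [hc, ha, ← hFf]; exact_mod_cast this
  -- hence every member exceeds `f/p`
  have hap : f < a * p := by
    have h : f ^ 2 * f < f ^ 2 * (a * p) := by
      calc f ^ 2 * f = f ^ 3 := by ring
        _ < a * b * c * p := hcon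
        _ = a * p * (b * c) := by ring
        _ ≤ a * p * f ^ 2 := mul_le_mul_of_nonneg_left hbc (by positivity)
        _ = f ^ 2 * (a * p) := by ring
    exact lt_of_mul_lt_mul_left h (sq_nonneg f)
  have hbp : f < b * p := by
    have h : f ^ 2 * f < f ^ 2 * (b * p) := by
      calc f ^ 2 * f = f ^ 3 := by ring
        _ < a * b * c * p := hcon
        _ = b * p * (c * a) := by ring
        _ ≤ b * p * f ^ 2 := mul_le_mul_of_nonneg_left hca (by positivity)
        _ = f ^ 2 * (b * p) := by ring
    exact lt_of_mul_lt_mul_left h (sq_nonneg f)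
  have hcp : f < c * p := by
    have h : f ^ 2 * f < f ^ 2 * (c * p) := by
      calc f ^ 2 * f = f ^ 3 := by ring
        _ < a * b * c * p := hcon
        _ = c * p * (a * b) := by ring
        _ ≤ c * p * f ^ 2 := mul_le_mul_of_nonneg_left hab (by positivity)
        _ = f ^ 2 * (c * p) := by ring
    exact lt_of_mul_lt_mul_left h (sq_nonneg f)
  -- `4 p² ≤ n³`
  have h4p : 4 * p ^ 2 ≤ (n : ℝ) ^ 3 := by
    have := mul_le_mul hE1' hE1' (by positivity) hn0.le
    nlinarith only [this, h40]
  -- the pair terms: `√(xy·log(4n·n!/(xy))) ≤ 2 ℓ √(abc/t₀)`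
  obtain ⟨R, hR⟩ : ∃ R : ℝ, R = Real.sqrt (a * b * c / t₀) := ⟨_, rfl⟩
  have hR0 : 0 ≤ R := by rw [hR]; exact Real.sqrt_nonneg _
  have hR2 : R ^ 2 = a * b * c / t₀ := by rw [hR, Real.sq_sqrt (by positivity)]
  have hXle : ∀ {x y z : ℝ}, 0 < x → 0 < y → t₀ ≤ z → x * y * z = a * b * c → f ^ 2 < x * y * p ^ 2 →
      Real.sqrt (x * y * ((1 + Real.log n) * Real.log (4 * n * n.factorial / (x * y)))) ≤ 3 * ℓ ^ 2 * R := by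
    intro x y z hx hy hz hprod hlt
    have hxy : 0 < x * y := mul_pos hx hy
    have hq : 4 * n * n.factorial / (x * y) ≤ (n : ℝ) ^ 4 := by
      rw [div_le_iff₀ hxy, hFf]
      calc 4 * (n : ℝ) * f ^ 2 ≤ 4 * n * (x * y * p ^ 2) := mul_le_mul_of_nonneg_left hlt.le (by positivity)
        _ = n * (x * y) * (4 * p ^ 2) := by ring
        _ ≤ n * (x * y) * (n : ℝ) ^ 3 := mul_le_mul_of_nonneg_left h4p (by positivity)
        _ = (n : ℝ) ^ 4 * (x * y) := by ring
    have hL : Real.log (4 * n * n.factorial / (x * y)) ≤ 4 * ℓ ^ 2 := by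
      calc Real.log (4 * n * n.factorial / (x * y)) ≤ Real.log ((n : ℝ) ^ 4) :=
            Real.log_le_log (by rw [hFf]; positivity) hq
        _ = 4 * Real.log n := by rw [Real.log_pow]; push_cast; ring
        _ = 4 * ℓ ^ 2 := by rw [hlog]
    have hGL : (1 + Real.log n) * Real.log (4 * n * n.factorial / (x * y)) ≤ (3 * ℓ ^ 2) ^ 2 := by
      have hG : 1 + Real.log n ≤ 2 * ℓ ^ 2 := by rw [← hlog]; linarith only [hlog1]
      have hG0 : 0 ≤ 1 + Real.log n := by linarith only [hlogpos]
      calc (1 + Real.log n) * Real.log (4 * n * n.factorial / (x * y)) ≤ (1 + Real.log n) * (4 * ℓ ^ 2) :=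
            mul_le_mul_of_nonneg_left hL hG0
        _ ≤ (2 * ℓ ^ 2) * (4 * ℓ ^ 2) := mul_le_mul_of_nonneg_right hG (by positivity)
        _ ≤ (3 * ℓ ^ 2) ^ 2 := by nlinarith only [pow_nonneg hℓpos.le 4]
    have hxyR : x * y ≤ a * b * c / t₀ := by
      rw [← hprod, le_div_iff₀ ht0]
      exact mul_le_mul_of_nonneg_left hz hxy.le
    calc Real.sqrt (x * y * ((1 + Real.log n) * Real.log (4 * n * n.factorial / (x * y))))
        ≤ Real.sqrt (x * y * (3 * ℓ ^ 2) ^ 2) := Real.sqrt_le_sqrt (mul_le_mul_of_nonneg_left hGL hxy.le)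
      _ = Real.sqrt (x * y) * (3 * ℓ ^ 2) := by
          rw [Real.sqrt_mul hxy.le, Real.sqrt_sq (by positivity)]
      _ ≤ Real.sqrt (a * b * c / t₀) * (3 * ℓ ^ 2) :=
          mul_le_mul_of_nonneg_right (Real.sqrt_le_sqrt hxyR) (by positivity)
      _ = 3 * ℓ ^ 2 * R := by rw [hR]; ring
  have hX1 : Real.sqrt (a * b * ((1 + Real.log n) * Real.log (4 * n * n.factorial / (a * b)))) ≤ 3 * ℓ ^ 2 * R :=
    hXle ha0 hb0 hUmin (by ring) (by nlinarith only [mul_lt_mul'' hap hbp hf0.le hf0.le])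
  have hX2 : Real.sqrt (b * c * ((1 + Real.log n) * Real.log (4 * n * n.factorial / (b * c)))) ≤ 3 * ℓ ^ 2 * R :=
    hXle hb0 hc0 hSmin (by ring) (by nlinarith only [mul_lt_mul'' hbp hcp hf0.le hf0.le])
  have hX3 : Real.sqrt (c * a * ((1 + Real.log n) * Real.log (4 * n * n.factorial / (c * a)))) ≤ 3 * ℓ ^ 2 * R :=
    hXle hc0 ha0 hTmin (by ring) (by nlinarith only [mul_lt_mul'' hcp hap hf0.le hf0.le])
  -- the middle term: `n! √(n!)/√(n(n-1)/6) ≤ √12 f^3/n`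
  have hs12 : Real.sqrt 12 < 4 := by
    rw [show (4 : ℝ) = Real.sqrt 16 by rw [show (16 : ℝ) = 4 ^ 2 by norm_num, Real.sqrt_sq (by norm_num)]]
    exact Real.sqrt_lt_sqrt (by norm_num) (by norm_num)
  have hG : (n.factorial : ℝ) * Real.sqrt (n.factorial : ℝ) / Real.sqrt (((n * (n - 1) : ℕ) : ℝ) / 6) ≤
      Real.sqrt 12 * f ^ 3 / n := by
    have h2 : ((n * (n - 1) : ℕ) : ℝ) = (n : ℝ) * ((n : ℝ) - 1) := by
      push_cast [Nat.cast_sub (show 1 ≤ n by omega)]; ring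
    have hd : (n : ℝ) / Real.sqrt 12 ≤ Real.sqrt (((n * (n - 1) : ℕ) : ℝ) / 6) := by
      rw [h2]
      have h12 : (0 : ℝ) < Real.sqrt 12 := by positivity
      rw [div_le_iff₀ h12]
      have h6 : (0 : ℝ) ≤ (n : ℝ) * ((n : ℝ) - 1) / 6 :=
        div_nonneg (mul_nonneg hn0.le (by linarith only [h40])) (by norm_num)
      rw [← Real.sqrt_mul h6 12]
      refine (le_of_eq (Real.sqrt_sq hn0.le).symm).trans (Real.sqrt_le_sqrt ?_)
      nlinarith only [h40]
    have hnum : 0 ≤ (n.factorial : ℝ) * Real.sqrt (n.factorial : ℝ) := by positivity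
    calc (n.factorial : ℝ) * Real.sqrt (n.factorial : ℝ) / Real.sqrt (((n * (n - 1) : ℕ) : ℝ) / 6)
        ≤ (n.factorial : ℝ) * Real.sqrt (n.factorial : ℝ) / ((n : ℝ) / Real.sqrt 12) :=
          div_le_div_of_nonneg_left hnum (by positivity) hd
      _ = Real.sqrt 12 * f ^ 3 / n := by rw [← hf, hFf]; field_simp
  -- assemble: `abc/4 ≤ f² + √12 f³/n + 180 f² ℓ² R / s`
  have h20 : (0 : ℝ) ≤ 20 * (n.factorial : ℝ) / s := by positivity
  have hsumX := mul_le_mul_of_nonneg_left (add_le_add (add_le_add hX1 hX2) hX3) h20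
  have hmain : a * b * c / 4 ≤ f ^ 2 + Real.sqrt 12 * f ^ 3 / n + 180 * f ^ 2 * ℓ ^ 2 * R / s := by
    have e : 20 * (n.factorial : ℝ) / s * (3 * ℓ ^ 2 * R + 3 * ℓ ^ 2 * R + 3 * ℓ ^ 2 * R) =
        180 * f ^ 2 * ℓ ^ 2 * R / s := by
      rw [hFf]; ring
    rw [e] at hsumX
    linarith only [hW, hG, hsumX, hFf]
  -- the first two terms are small: `64 f³ ≤ abc·n`, so `f² ≤ abc/32` and `√12 f³/n ≤ abc/16`
  have h64 : 64 * f ^ 3 ≤ a * b * c * n := by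
    have := mul_le_mul_of_nonneg_left hE1' hN0.le
    nlinarith only [this, hcon]
  have hT1 : f ^ 2 ≤ a * b * c / 32 := by
    rw [le_div_iff₀ (by norm_num : (0 : ℝ) < 32)]
    have h1 : f ^ 2 * ((n : ℝ) / 2) ≤ f ^ 2 * f := mul_le_mul_of_nonneg_left hfn (sq_nonneg f)
    have h2 : f ^ 2 * 32 * n ≤ a * b * c * n := by nlinarith only [h1, h64]
    exact le_of_mul_le_mul_right h2 hn0
  have hT2 : Real.sqrt 12 * f ^ 3 / n ≤ a * b * c / 16 := by
    rw [div_le_iff₀ hn0]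
    have := mul_le_mul_of_nonneg_right hs12.le (by positivity : (0 : ℝ) ≤ f ^ 3)
    linarith only [this, h64]
  have h8 : a * b * c / 8 ≤ 180 * f ^ 2 * ℓ ^ 2 * R / s := by linarith only [hmain, hT1, hT2, hN0]
  -- square and unfold the threshold
  have ht0' : t₀ ≠ 0 := ht0.ne'
  have hn0' : (n : ℝ) ≠ 0 := hn0.ne'
  have hs0' : s ≠ 0 := hs0.ne'
  have h8sq : (a * b * c) ^ 2 / 64 ≤ 32400 * f ^ 4 * ℓ ^ 4 * (a * b * c) / (t₀ * n) := by
    calc (a * b * c) ^ 2 / 64 = (a * b * c / 8) ^ 2 := by ring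
      _ ≤ (180 * f ^ 2 * ℓ ^ 2 * R / s) ^ 2 := pow_le_pow_left₀ (by positivity) h8 2
      _ = 32400 * f ^ 4 * ℓ ^ 4 * R ^ 2 / s ^ 2 := by ring
      _ = 32400 * f ^ 4 * ℓ ^ 4 * (a * b * c) / (t₀ * n) := by rw [hR2, ← hns]; field_simp
  have h9 : (a * b * c) ^ 2 * (t₀ * n) ≤ 32400 * f ^ 4 * ℓ ^ 4 * (a * b * c) * 64 := by
    have ht0n : 0 < t₀ * n := by positivity
    rw [div_le_iff₀ (by norm_num : (0 : ℝ) < 64), div_mul_eq_mul_div, le_div_iff₀ ht0n] at h8sq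
    exact h8sq
  rw [htn] at h9
  have h10 : (a * b * c * p * 3000000) * (a * b * c * f * ℓ ^ 4) ≤ (2073600 * f ^ 3) * (a * b * c * f * ℓ ^ 4) := by
    nlinarith only [h9]
  have h11 : a * b * c * p * 3000000 ≤ 2073600 * f ^ 3 := le_of_mul_le_mul_right h10 (by positivity)
  linarith only [h11, hcon, pow_pos hf0 3]

end Summit.MatrixMultiplication.MatrixMultiplication.Theorems.PolynomialSlack
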